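import Summits.HodgeConjecture.CorCM.IrreducibleOddWeightsRightIdealsPivot
import HarnessLib

/-!
# Canonical pivot, I: the EXACT defect `dim Hg(A₀) + dim Hg(A₁) − dim Hg(A₀ × A₁)` with NO hypothesis — fibre sums
# over the orbits of the POINTWISE STABILISER OF THE OTHER SLOT

COR-CM (cell `pub-hodgecm2`, binder seat `b16` gen 65, count-neutral claim CANONICAL PIVOT, file C1 — abstract `G`-set
level; theorems only, no definition, no named fact, no `sorry`).  NEW as stated, hence under `Summits/`.  HONEST FRAMING:
finite-dimensional linear algebra about the Kubota–Dodson rank of a pair of CM types (`dim Hg(A₀ × A₁)` versus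
`dim Hg(A₀) + dim Hg(A₁)` for abelian varieties with complex multiplication); `HC_CM` is neither used nor asserted.

SETTING (gen 64 R1/R3 `IrreducibleOddWeightsRightIdeals{,Pivot}`).  A group `G` acts on finite slots `E_i`
(`G = Aut(ℂ)`, `E_i = Hom(K_i, ℂ)`); types `Φ_i ⊆ E_i` with type vectors `u_i = 2·𝟙_{Φ_i} − 1`; MATRIX-COEFFICIENT SPACES
`MC_i = span{c_{i,x} : x ∈ E_i} ≤ ℚ^G`, `c_{i,x}(g) = u_i(g·x)`.  R1: **`dim Hg(A₀) + dim Hg(A₁) − dim Hg(A₀ × A₁) =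
dim(MC₀ ∩ MC₁)`** exactly.  R3 computed `MC₀ ∩ MC₁ = F₀ ∩ F₁` through FIBRE SUMS `F_κ` of a PIVOT `r_κ : E_κ → Y` under
two hypotheses: (H1) a subgroup `N` transitive on the fibres, (H2) `N ≤ ⟨PW₀ ∪ PW₁⟩`, `PW_κ = {g | g·x = x ∀ x ∈ E_κ}` the
POINTWISE STABILISERS of the slots (`= Aut(ℂ/L_κ)`, `L_κ` the Galois closure); at the level of CM fields (gen 64 R4) this
was the hypothesis (GL) "the Galois closures meet inside the pivot field", flagged HONEST OPEN: "(GL) is sufficient, not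
necessary".  THIS FILE removes every hypothesis: the pivot is CANONICAL.

* §1 Orbit sums are fibre sums: for a subgroup `N` the fibres of the orbit map `x ↦ N·x` are the `N`-orbits, on which
  `N` is (tautologically) transitive, so R3's (H1) holds for free (`exists_smul_eq_of_orbit_eq`,
  `filter_orbit_eq_eq_filter_exists_smul`, `span_fibreSum_eq_span_fibreSum_apply`).
* §2 **`span_coeff_inf_eq_span_orbitSum_inf`** — for EVERY subgroup `N ≤ ⟨PW₀ ∪ PW₁⟩`:
  **`MC₀ ∩ MC₁ = F₀^N ∩ F₁^N`**, `F_κ^N = span{ g ↦ Σ_{x' ∈ N·x} u_κ(g·x') : x ∈ E_κ }` (ORBIT SUMS of matrix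
  coefficients).  THE CANONICAL CHOICES: `N = PW₁` (its orbits on `E₁` are points, so `F₁^{PW₁} = MC₁`):
  **`span_coeff_inf_eq_span_stabOrbitSum_inf_span_coeff`** — `MC₀ ∩ MC₁ = F₀^{PW₁} ∩ MC₁`; both ways:
  **`span_coeff_inf_eq_span_stabOrbitSum_inf`** — **`MC₀ ∩ MC₁ = F₀^{PW₁} ∩ F₁^{PW₀}`**: the common matrix coefficients
  are the common combinations of the matrix coefficients of each slot SUMMED OVER THE ORBITS OF THE POINTWISE STABILISER
  OF THE OTHER SLOT.  (For `Aut(ℂ)`: `PW₁ = Aut(ℂ/L₁)`, whose orbits on `Hom(K₀, ℂ)` are the classes of embeddings that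
  agree on the trace `K₀ ∩ L₁` — file C2 `IrreducibleOddWeightsCanonicalPivotCMFields`.)
* §3 THE EXACT DEFECT, UNCONDITIONALLY: **`typeRank_add_typeRank_eq_add_finrank_stabOrbitSum_inf`** —
  `rank Φ₀ + rank Φ₁ = rank(Φ₀, Φ₁) + 1 + dim(F₀^{PW₁} ∩ F₁^{PW₀})`, i.e.
  **`dim Hg(A₀) + dim Hg(A₁) − dim Hg(A₀ × A₁) = dim(F₀^{PW₁} ∩ F₁^{PW₀})`**; additive iff the intersection is `0`
  (`typeRank_sigmaType_add_card_eq_iff_stabOrbitSum_inf_eq_bot`); general `N` (`…_orbitSum_…`).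
* §4 One-sided, TYPE-FREE consequences: `F₀^{PW₁} = 0` suffices (`typeRank_sigmaType_add_card_eq_of_span_stabOrbitSum_eq_bot`);
  `PW₁` is NORMAL, so its orbit sums of all translates vanish as soon as those of `u₀` do
  (`typeRank_sigmaType_add_card_eq_of_stabOrbit_sums_eq_zero` — `Φ₀` meets every `PW₁`-orbit in half its points; the
  seat's gen 63 S8 `…ShadowIdealsStabilizerBalance` asks this only on the coarser orbits of point stabilisers and is the
  stronger criterion of this kind), and in particular **`typeRank_sigmaType_add_card_eq_of_stabOrbit_rho_stable`** — if
  every `PW₁`-orbit on `E₀` is stable under the conjugation `ρ`, the pair is additive FOR EVERY CM type `Φ₀` and every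
  `Φ₁` (for `Aut(ℂ)`: the trace `K₀ ∩ L₁` is totally real — C2).

## References

* [Deligne1982HodgeCycles] P. Deligne, *Hodge cycles on abelian varieties*, LNM 900 (1982), I.3.4, I.5 (p. 62), I Ex. 3.7.
* [Gordon1999HodgeAVSurvey] B. B. Gordon, *A survey of the Hodge conjecture for abelian varieties*, §3 Theorem (Imai,
  Murty) with proof, 7.5–7.7, 9.4.3.
* [Serre1977] J.-P. Serre, *Linear Representations of Finite Groups*, GTM 42, §3.3, §7 Ex. 7.2.
* [Shimura1998] G. Shimura, *Abelian Varieties with Complex Multiplication and Modular Functions*, §8.1, §8.3.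
-/

set_option autoImplicit false

noncomputable section

open scoped BigOperators Classical

universe u v w

namespace Summit.HodgeConjecture.CorCM.IrrOdd

open Literature.NumberTheory.ComplexMultiplication

variable {G : Type w} [Group G]

/-! ### §1 Orbit sums are fibre sums -/

section OrbitSum

variable {X : Type v} [MulAction G X] [Fintype X]

omit [Fintype X] in
/-- The pointwise stabiliser of a slot is the kernel of the permutation representation: `g ∈ ker ⟺ g·x = x ∀ x`.
[cite: Serre1977, §7 Ex. 7.2] -/
theorem mem_ker_toPermHom_iff (g : G) : g ∈ (MulAction.toPermHom G X).ker ↔ ∀ x : X, g • x = x := by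
  rw [MonoidHom.mem_ker, Equiv.ext_iff]
  rfl

omit [Fintype X] in
/-- On a subgroup `N`, the fibres of the orbit map `x ↦ N·x` are the `N`-orbits, on which `N` is transitive: R3's (H1)
for free. [folklore] -/
theorem exists_smul_eq_of_orbit_eq (N : Subgroup G) {x x' : X}
    (h : MulAction.orbit N x = MulAction.orbit N x') : ∃ n ∈ N, n • x = x' := by
  rw [MulAction.orbit_eq_iff, MulAction.mem_orbit_iff] at h
  obtain ⟨m, hm⟩ := h
  refine ⟨((m⁻¹ : N) : G), (m⁻¹).2, ?_⟩
  rw [← hm]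
  change ((m⁻¹ : N) : G) • ((m : G) • x') = x'
  rw [Subgroup.coe_inv, inv_smul_smul]

/-- The fibre of the orbit map through `x₀` is the set of `N`-translates of `x₀`. [folklore] -/
theorem filter_orbit_eq_eq_filter_exists_smul (N : Subgroup G) (x₀ : X) :
    Finset.univ.filter (fun x : X => MulAction.orbit N x = MulAction.orbit N x₀) =
      Finset.univ.filter (fun x : X => ∃ n ∈ N, n • x₀ = x) := by
  refine Finset.filter_congr fun x _ => ?_
  rw [MulAction.orbit_eq_iff, MulAction.mem_orbit_iff]
  constructor
  · rintro ⟨n, rfl⟩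
    exact ⟨(n : G), n.2, rfl⟩
  · rintro ⟨n, hn, rfl⟩
    exact ⟨⟨n, hn⟩, rfl⟩

/-- For any map `r : X → Y` the fibre sums indexed by the points of `Y` and the fibre sums indexed by the points of `X`
(each through its own fibre) span the same subspace of `ℚ^G`: fibres over points outside the image are empty.
[folklore] -/
theorem span_fibreSum_eq_span_fibreSum_apply {Y : Type*} [DecidableEq Y] (Φ : Set X) (r : X → Y) :
    Submodule.span ℚ (Set.range fun y : Y => fun g : G =>
        ∑ x ∈ Finset.univ.filter (fun x => r x = y), antiVec Φ g x) =
      Submodule.span ℚ (Set.range fun x₀ : X => fun g : G =>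
        ∑ x ∈ Finset.univ.filter (fun x => r x = r x₀), antiVec Φ g x) := by
  apply le_antisymm
  · rw [Submodule.span_le]
    rintro _ ⟨y, rfl⟩
    by_cases hy : ∃ x₀, r x₀ = y
    · obtain ⟨x₀, rfl⟩ := hy
      exact Submodule.subset_span ⟨x₀, rfl⟩
    · have hempty : Finset.univ.filter (fun x => r x = y) = ∅ :=
        Finset.filter_eq_empty_iff.2 fun x _ hx => hy ⟨x, hx⟩
      have h0 : (fun g : G => ∑ x ∈ Finset.univ.filter (fun x => r x = y), antiVec Φ g x) = 0 := by
        funext g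
        rw [hempty, Finset.sum_empty, Pi.zero_apply]
      rw [SetLike.mem_coe]
      dsimp only
      rw [h0]
      exact Submodule.zero_mem _
  · rw [Submodule.span_le]
    rintro _ ⟨x₀, rfl⟩
    exact Submodule.subset_span ⟨r x₀, rfl⟩

omit [Fintype X] in
/-- A sum of matrix coefficients over any finite set of points lies in the matrix-coefficient space. [folklore] -/
theorem sum_coeff_mem_span_coeff (Φ : Set X) (S : Finset X) :
    (fun g : G => ∑ x ∈ S, antiVec Φ g x) ∈ Submodule.span ℚ (Set.range fun x : X => fun g : G => antiVec Φ g x) := by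
  have hS : (fun g : G => ∑ x ∈ S, antiVec Φ g x) = ∑ x ∈ S, (fun g : G => antiVec Φ g x) := by
    funext g
    simp only [Finset.sum_apply]
  rw [hS]
  exact Submodule.sum_mem _ fun x _ => Submodule.subset_span ⟨x, rfl⟩

/-- **Orbit sums of the pointwise stabiliser are determined by the base vector** (`PW` is NORMAL in `G`): the
`g`-translate of the orbit sum through `x₀` is the orbit sum of the base vector through `g·x₀`:
`Σ_{x ∈ PW·x₀} u(g·x) = Σ_{x ∈ PW·(g·x₀)} u(x)`. [cite: Serre1977, §7 Ex. 7.2] -/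
theorem stabOrbit_sum_antiVec_eq {W : Type*} [MulAction G W] (Φ : Set X) (g : G) (x₀ : X) :
    ∑ x ∈ Finset.univ.filter (fun x : X => ∃ n : G, (∀ y : W, n • y = y) ∧ n • x₀ = x), antiVec Φ g x =
      ∑ x ∈ Finset.univ.filter (fun x : X => ∃ n : G, (∀ y : W, n • y = y) ∧ n • (g • x₀) = x),
        antiVec Φ (1 : G) x := by
  have hmap : Finset.univ.filter (fun x : X => ∃ n : G, (∀ y : W, n • y = y) ∧ n • (g • x₀) = x) =
      (Finset.univ.filter (fun x : X => ∃ n : G, (∀ y : W, n • y = y) ∧ n • x₀ = x)).map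
        (MulAction.toPerm g).toEmbedding := by
    ext x
    simp only [Finset.mem_filter, Finset.mem_univ, true_and, Finset.mem_map, Equiv.toEmbedding_apply,
      MulAction.toPerm_apply]
    constructor
    · rintro ⟨n, hn, rfl⟩
      refine ⟨(g⁻¹ * n * g) • x₀, ⟨g⁻¹ * n * g, fun y => ?_, rfl⟩, ?_⟩
      · rw [mul_smul, mul_smul, hn, inv_smul_smul]
      · rw [mul_smul, mul_smul, smul_inv_smul]
    · rintro ⟨x', ⟨n, hn, rfl⟩, rfl⟩
      refine ⟨g * n * g⁻¹, fun y => ?_, ?_⟩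
      · rw [mul_smul, mul_smul, hn, smul_inv_smul]
      · rw [mul_smul, mul_smul, inv_smul_smul]
  rw [hmap, Finset.sum_map]
  exact Finset.sum_congr rfl fun x _ => antiVec_apply_eq_antiVec_one_smul Φ g x

/-- **A `ρ`-odd vector sums to zero over a `ρ`-stable orbit**: if the `PW`-orbit of `x₀` contains `ρ·x₀` (`ρ` a
conjugation commuting with the action, `Φ` a CM type for `ρ`), then `Σ_{x ∈ PW·x₀} u_1(Φ)(x) = 0`.
[cite: Shimura1998, §8.3] -/
theorem stabOrbit_sum_antiVec_eq_zero_of_rho_mem {W : Type*} [MulAction G W] {ρ : G} {Φ : Set X}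
    (h : IsCMTypeWith ρ Φ) (x₀ : X) (hρ : ∃ n : G, (∀ y : W, n • y = y) ∧ n • x₀ = ρ • x₀) :
    ∑ x ∈ Finset.univ.filter (fun x : X => ∃ n : G, (∀ y : W, n • y = y) ∧ n • x₀ = x), antiVec Φ (1 : G) x = 0 := by
  obtain ⟨n₀, hn₀, hn₀x⟩ := hρ
  refine Finset.sum_involution (fun x _ => ρ • x) (fun x _ => ?_) (fun x _ _ => h.rho_smul_ne x) (fun x hx => ?_)
    (fun x _ => h.invol x)
  · simp only [antiVec, h.translateInd_rho_smul]
    ring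
  · simp only [Finset.mem_filter, Finset.mem_univ, true_and] at hx ⊢
    obtain ⟨n, hn, rfl⟩ := hx
    refine ⟨n * n₀, fun y => by rw [mul_smul, hn₀, hn], ?_⟩
    rw [mul_smul, hn₀x, h.comm]

end OrbitSum

/-! ### §2 The transfer `MC₀ ∩ MC₁ = F₀^N ∩ F₁^N` for orbit sums, and the canonical choices of `N` -/

section Transfer

variable {I : Type u} {E : I → Type v} [∀ i, MulAction G (E i)] [∀ i, Fintype (E i)]

/-- **`MC₀ ∩ MC₁ = F₀^N ∩ F₁^N` FOR EVERY SUBGROUP `N ≤ ⟨PW₀ ∪ PW₁⟩`**, where `F_κ^N` is spanned by the ORBIT SUMS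
`g ↦ Σ_{x' ∈ N·x} u_κ(g·x')` (`x ∈ E_κ`) of the matrix coefficients: R3's transfer with the orbit maps as pivots, whose
hypothesis (H1) is automatic.  (H2) alone remains, and it has canonical solutions (below).
[cite: Gordon1999HodgeAVSurvey, §3 Theorem (proof)] [cite: Serre1977, §3.3] -/
theorem span_coeff_inf_eq_span_orbitSum_inf (Φ : ∀ i, Set (E i)) {i₀ i₁ : I} (N : Subgroup G)
    (hNcl : (N : Set G) ⊆ Subgroup.closure ({g : G | ∀ x : E i₀, g • x = x} ∪ {g : G | ∀ x : E i₁, g • x = x})) :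
    Submodule.span ℚ (Set.range fun x : E i₀ => fun g : G => antiVec (Φ i₀) g x) ⊓
        Submodule.span ℚ (Set.range fun x : E i₁ => fun g : G => antiVec (Φ i₁) g x) =
      Submodule.span ℚ (Set.range fun x₀ : E i₀ => fun g : G =>
          ∑ x ∈ Finset.univ.filter (fun x : E i₀ => ∃ n ∈ N, n • x₀ = x), antiVec (Φ i₀) g x) ⊓
        Submodule.span ℚ (Set.range fun x₁ : E i₁ => fun g : G =>
          ∑ x ∈ Finset.univ.filter (fun x : E i₁ => ∃ n ∈ N, n • x₁ = x), antiVec (Φ i₁) g x) := by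
  have h := span_coeff_inf_eq_span_fibreSum_inf Φ (Y := Set (E i₀) ⊕ Set (E i₁))
    (fun x : E i₀ => Sum.inl (MulAction.orbit N x)) (fun x : E i₁ => Sum.inr (MulAction.orbit N x)) N
    (fun x x' hxx' => exists_smul_eq_of_orbit_eq N (Sum.inl_injective hxx'))
    (fun x x' hxx' => exists_smul_eq_of_orbit_eq N (Sum.inr_injective hxx')) hNcl
  rw [h, span_fibreSum_eq_span_fibreSum_apply (Φ i₀)
      (fun x : E i₀ => (Sum.inl (MulAction.orbit N x) : Set (E i₀) ⊕ Set (E i₁))),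
    span_fibreSum_eq_span_fibreSum_apply (Φ i₁)
      (fun x : E i₁ => (Sum.inr (MulAction.orbit N x) : Set (E i₀) ⊕ Set (E i₁)))]
  have e₀ : ∀ x₀ : E i₀, Finset.univ.filter (fun x : E i₀ =>
      (Sum.inl (MulAction.orbit N x) : Set (E i₀) ⊕ Set (E i₁)) = Sum.inl (MulAction.orbit N x₀)) =
        Finset.univ.filter (fun x : E i₀ => ∃ n ∈ N, n • x₀ = x) := fun x₀ => by
    rw [← filter_orbit_eq_eq_filter_exists_smul]
    exact Finset.filter_congr fun x _ => Sum.inl_injective.eq_iff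
  have e₁ : ∀ x₁ : E i₁, Finset.univ.filter (fun x : E i₁ =>
      (Sum.inr (MulAction.orbit N x) : Set (E i₀) ⊕ Set (E i₁)) = Sum.inr (MulAction.orbit N x₁)) =
        Finset.univ.filter (fun x : E i₁ => ∃ n ∈ N, n • x₁ = x) := fun x₁ => by
    rw [← filter_orbit_eq_eq_filter_exists_smul]
    exact Finset.filter_congr fun x _ => Sum.inr_injective.eq_iff
  simp only [e₀, e₁]

/-- **THE CANONICAL PIVOT, one-sided form: `MC₀ ∩ MC₁ = F₀^{PW₁} ∩ MC₁`** — the common matrix coefficients are the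
elements of `MC₁` which are combinations of the matrix coefficients of slot `0` SUMMED OVER THE ORBITS OF THE POINTWISE
STABILISER `PW₁ = {n | n·y = y ∀ y ∈ E₁}` OF SLOT `1` (`N = PW₁ ≤ ⟨PW₀ ∪ PW₁⟩`; its orbits on `E₁` are points).  No
hypothesis. [cite: Gordon1999HodgeAVSurvey, §3 Theorem (proof)] [cite: Serre1977, §3.3 and §7 Ex. 7.2] -/
theorem span_coeff_inf_eq_span_stabOrbitSum_inf_span_coeff (Φ : ∀ i, Set (E i)) (i₀ i₁ : I) :
    Submodule.span ℚ (Set.range fun x : E i₀ => fun g : G => antiVec (Φ i₀) g x) ⊓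
        Submodule.span ℚ (Set.range fun x : E i₁ => fun g : G => antiVec (Φ i₁) g x) =
      Submodule.span ℚ (Set.range fun x₀ : E i₀ => fun g : G =>
          ∑ x ∈ Finset.univ.filter (fun x : E i₀ => ∃ n : G, (∀ y : E i₁, n • y = y) ∧ n • x₀ = x),
            antiVec (Φ i₀) g x) ⊓
        Submodule.span ℚ (Set.range fun x : E i₁ => fun g : G => antiVec (Φ i₁) g x) := by
  have h := span_coeff_inf_eq_span_orbitSum_inf Φ (i₀ := i₀) (i₁ := i₁) (MulAction.toPermHom G (E i₁)).ker
    (fun n hn => Subgroup.subset_closure (Or.inr ((mem_ker_toPermHom_iff n).1 hn)))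
  have e₀ : ∀ x₀ : E i₀, Finset.univ.filter (fun x : E i₀ => ∃ n ∈ (MulAction.toPermHom G (E i₁)).ker, n • x₀ = x) =
      Finset.univ.filter (fun x : E i₀ => ∃ n : G, (∀ y : E i₁, n • y = y) ∧ n • x₀ = x) := fun x₀ =>
    Finset.filter_congr fun x _ => by simp only [mem_ker_toPermHom_iff]
  have e₁ : (fun x₁ : E i₁ => fun g : G => ∑ x ∈ Finset.univ.filter
      (fun x : E i₁ => ∃ n ∈ (MulAction.toPermHom G (E i₁)).ker, n • x₁ = x), antiVec (Φ i₁) g x) =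
        fun x₁ : E i₁ => fun g : G => antiVec (Φ i₁) g x₁ := by
    funext x₁ g
    have hfilter : Finset.univ.filter
        (fun x : E i₁ => ∃ n ∈ (MulAction.toPermHom G (E i₁)).ker, n • x₁ = x) = {x₁} := by
      ext x
      simp only [Finset.mem_filter, Finset.mem_univ, true_and, Finset.mem_singleton, mem_ker_toPermHom_iff]
      constructor
      · rintro ⟨n, hn, rfl⟩
        exact hn x₁
      · rintro rfl
        exact ⟨1, fun y => one_smul G y, one_smul G x⟩
    rw [hfilter, Finset.sum_singleton]
  rw [h, e₁]
  simp only [e₀]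

/-- **THE CANONICAL PIVOT: `MC₀ ∩ MC₁ = F₀^{PW₁} ∩ F₁^{PW₀}`** — the common matrix coefficients of two slots are exactly
the common combinations of the matrix coefficients of each slot summed over the orbits of the pointwise stabiliser of the
OTHER slot.  No hypothesis on the slots, the types or the group. [cite: Gordon1999HodgeAVSurvey, §3 Theorem (proof)]
[cite: Serre1977, §3.3 and §7 Ex. 7.2] -/
theorem span_coeff_inf_eq_span_stabOrbitSum_inf (Φ : ∀ i, Set (E i)) (i₀ i₁ : I) :
    Submodule.span ℚ (Set.range fun x : E i₀ => fun g : G => antiVec (Φ i₀) g x) ⊓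
        Submodule.span ℚ (Set.range fun x : E i₁ => fun g : G => antiVec (Φ i₁) g x) =
      Submodule.span ℚ (Set.range fun x₀ : E i₀ => fun g : G =>
          ∑ x ∈ Finset.univ.filter (fun x : E i₀ => ∃ n : G, (∀ y : E i₁, n • y = y) ∧ n • x₀ = x),
            antiVec (Φ i₀) g x) ⊓
        Submodule.span ℚ (Set.range fun x₁ : E i₁ => fun g : G =>
          ∑ x ∈ Finset.univ.filter (fun x : E i₁ => ∃ n : G, (∀ y : E i₀, n • y = y) ∧ n • x₁ = x),
            antiVec (Φ i₁) g x) := by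
  have h₀ := span_coeff_inf_eq_span_stabOrbitSum_inf_span_coeff (G := G) Φ i₀ i₁
  have h₁ := span_coeff_inf_eq_span_stabOrbitSum_inf_span_coeff (G := G) Φ i₁ i₀
  rw [inf_comm] at h₁
  -- the orbit-sum spans lie in the coefficient spaces
  have hle₀ : Submodule.span ℚ (Set.range fun x₀ : E i₀ => fun g : G =>
      ∑ x ∈ Finset.univ.filter (fun x : E i₀ => ∃ n : G, (∀ y : E i₁, n • y = y) ∧ n • x₀ = x),
        antiVec (Φ i₀) g x) ≤ Submodule.span ℚ (Set.range fun x : E i₀ => fun g : G => antiVec (Φ i₀) g x) := by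
    rw [Submodule.span_le]
    rintro _ ⟨x₀, rfl⟩
    exact sum_coeff_mem_span_coeff (Φ i₀) _
  have hle₁ : Submodule.span ℚ (Set.range fun x₁ : E i₁ => fun g : G =>
      ∑ x ∈ Finset.univ.filter (fun x : E i₁ => ∃ n : G, (∀ y : E i₀, n • y = y) ∧ n • x₁ = x),
        antiVec (Φ i₁) g x) ≤ Submodule.span ℚ (Set.range fun x : E i₁ => fun g : G => antiVec (Φ i₁) g x) := by
    rw [Submodule.span_le]
    rintro _ ⟨x₁, rfl⟩
    exact sum_coeff_mem_span_coeff (Φ i₁) _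
  exact le_antisymm (le_inf (h₀ ▸ inf_le_left) (h₁ ▸ inf_le_left)) (inf_le_inf hle₀ hle₁)

end Transfer

/-! ### §3 The exact defect, unconditionally -/

section Defect

variable {I : Type u} {E : I → Type v} [∀ i, MulAction G (E i)] [Fintype I] [∀ i, Fintype (E i)]
  [∀ i, Nonempty (E i)]

/-- **THE EXACT DEFECT WITH NO HYPOTHESIS: `rank Φ₀ + rank Φ₁ = rank(Φ₀, Φ₁) + 1 + dim(F₀^{PW₁} ∩ F₁^{PW₀})`**, i.e.
**`dim Hg(A₀) + dim Hg(A₁) − dim Hg(A₀ × A₁) = dim(F₀^{PW₁} ∩ F₁^{PW₀})`** — the codimension of `Hg(A₀ × A₁)` in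
`Hg(A₀) × Hg(A₁)` is the dimension of the space of common combinations of the ORBIT SUMS of the matrix coefficients, each
slot summed over the orbits of the pointwise stabiliser of the other.  Gen 64 R3/R4's exact pivot formula is the case in
which these orbits are the fibres of the restriction to a common Galois subfield; here nothing is assumed.
[cite: Gordon1999HodgeAVSurvey, §3 Theorem and 7.5–7.7] [cite: Deligne1982HodgeCycles, I.5 (p. 62)] -/
theorem typeRank_add_typeRank_eq_add_finrank_stabOrbitSum_inf {ρ : G} {Φ : ∀ i, Set (E i)}
    (h : ∀ i, IsCMTypeWith ρ (Φ i)) {i₀ i₁ : I} (hI : ∀ j, j = i₀ ∨ j = i₁) (h01 : i₀ ≠ i₁) :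
    typeRank G (Φ i₀) + typeRank G (Φ i₁) = typeRank G (sigmaType Φ) + 1 +
      Module.finrank ℚ (Submodule.span ℚ (Set.range fun x₀ : E i₀ => fun g : G =>
            ∑ x ∈ Finset.univ.filter (fun x : E i₀ => ∃ n : G, (∀ y : E i₁, n • y = y) ∧ n • x₀ = x),
              antiVec (Φ i₀) g x) ⊓
          Submodule.span ℚ (Set.range fun x₁ : E i₁ => fun g : G =>
            ∑ x ∈ Finset.univ.filter (fun x : E i₁ => ∃ n : G, (∀ y : E i₀, n • y = y) ∧ n • x₁ = x),
              antiVec (Φ i₁) g x) : Submodule ℚ (G → ℚ)) := by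
  rw [typeRank_add_typeRank_eq_of_pair h hI h01, span_coeff_inf_eq_span_stabOrbitSum_inf Φ i₀ i₁]

/-- **`Hg(A₀ × A₁) = Hg(A₀) × Hg(A₁)` IFF `F₀^{PW₁} ∩ F₁^{PW₀} = 0`** — unconditional criterion.
[cite: Gordon1999HodgeAVSurvey, §3 Theorem and 7.5–7.7] -/
theorem typeRank_sigmaType_add_card_eq_iff_stabOrbitSum_inf_eq_bot {ρ : G} {Φ : ∀ i, Set (E i)}
    (h : ∀ i, IsCMTypeWith ρ (Φ i)) {i₀ i₁ : I} (hI : ∀ j, j = i₀ ∨ j = i₁) (h01 : i₀ ≠ i₁) :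
    typeRank G (sigmaType Φ) + Fintype.card I = (∑ i, typeRank G (Φ i)) + 1 ↔
      Submodule.span ℚ (Set.range fun x₀ : E i₀ => fun g : G =>
            ∑ x ∈ Finset.univ.filter (fun x : E i₀ => ∃ n : G, (∀ y : E i₁, n • y = y) ∧ n • x₀ = x),
              antiVec (Φ i₀) g x) ⊓
          Submodule.span ℚ (Set.range fun x₁ : E i₁ => fun g : G =>
            ∑ x ∈ Finset.univ.filter (fun x : E i₁ => ∃ n : G, (∀ y : E i₀, n • y = y) ∧ n • x₁ = x),
              antiVec (Φ i₁) g x) = (⊥ : Submodule ℚ (G → ℚ)) := by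
  rw [typeRank_sigmaType_add_card_eq_iff_inf_eq_bot_of_pair h hI h01, span_coeff_inf_eq_span_stabOrbitSum_inf Φ i₀ i₁]

/-- General `N ≤ ⟨PW₀ ∪ PW₁⟩`: **`rank Φ₀ + rank Φ₁ = rank(Φ₀, Φ₁) + 1 + dim(F₀^N ∩ F₁^N)`** for the `N`-orbit sums —
every admissible `N` computes the defect exactly; a smaller `N` has finer orbits and more orbit sums, the coarsest
admissible orbits being those of `⟨PW₀ ∪ PW₁⟩` itself (on `E₀` these are the `PW₁`-orbits).
[cite: Gordon1999HodgeAVSurvey, §3 Theorem and 7.5–7.7] -/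
theorem typeRank_add_typeRank_eq_add_finrank_orbitSum_inf {ρ : G} {Φ : ∀ i, Set (E i)}
    (h : ∀ i, IsCMTypeWith ρ (Φ i)) {i₀ i₁ : I} (hI : ∀ j, j = i₀ ∨ j = i₁) (h01 : i₀ ≠ i₁) (N : Subgroup G)
    (hNcl : (N : Set G) ⊆ Subgroup.closure ({g : G | ∀ x : E i₀, g • x = x} ∪ {g : G | ∀ x : E i₁, g • x = x})) :
    typeRank G (Φ i₀) + typeRank G (Φ i₁) = typeRank G (sigmaType Φ) + 1 +
      Module.finrank ℚ (Submodule.span ℚ (Set.range fun x₀ : E i₀ => fun g : G =>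
            ∑ x ∈ Finset.univ.filter (fun x : E i₀ => ∃ n ∈ N, n • x₀ = x), antiVec (Φ i₀) g x) ⊓
          Submodule.span ℚ (Set.range fun x₁ : E i₁ => fun g : G =>
            ∑ x ∈ Finset.univ.filter (fun x : E i₁ => ∃ n ∈ N, n • x₁ = x), antiVec (Φ i₁) g x) :
          Submodule ℚ (G → ℚ)) := by
  rw [typeRank_add_typeRank_eq_of_pair h hI h01, span_coeff_inf_eq_span_orbitSum_inf Φ N hNcl]

/-! ### §4 One-sided, type-free consequences -/

/-- **One slot suffices: `F₀^{PW₁} = 0` ⟹ `Hg(A₀ × A₁) = Hg(A₀) × Hg(A₁)`.**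
[cite: Gordon1999HodgeAVSurvey, §3 Theorem and 7.5–7.7] -/
theorem typeRank_sigmaType_add_card_eq_of_span_stabOrbitSum_eq_bot {ρ : G} {Φ : ∀ i, Set (E i)}
    (h : ∀ i, IsCMTypeWith ρ (Φ i)) {i₀ i₁ : I} (hI : ∀ j, j = i₀ ∨ j = i₁) (h01 : i₀ ≠ i₁)
    (h0 : Submodule.span ℚ (Set.range fun x₀ : E i₀ => fun g : G =>
        ∑ x ∈ Finset.univ.filter (fun x : E i₀ => ∃ n : G, (∀ y : E i₁, n • y = y) ∧ n • x₀ = x),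
          antiVec (Φ i₀) g x) = (⊥ : Submodule ℚ (G → ℚ))) :
    typeRank G (sigmaType Φ) + Fintype.card I = (∑ i, typeRank G (Φ i)) + 1 := by
  rw [typeRank_sigmaType_add_card_eq_iff_stabOrbitSum_inf_eq_bot h hI h01, h0, bot_inf_eq]

/-- **`Φ₀` meeting every `PW₁`-orbit on `E₀` in half its points ⟹ `Hg(A₀ × A₁) = Hg(A₀) × Hg(A₁)` whatever `Φ₁`** —
since `PW₁` is normal, the orbit sums of all translates of `u₀` vanish with those of `u₀` (`stabOrbit_sum_antiVec_eq`).
(Gen 63 S8 asks the balance only on the coarser orbits of the stabilisers of single points of `E₁`, a weaker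
hypothesis.) [cite: Gordon1999HodgeAVSurvey, §3 Theorem (proof), 7.7 and 9.4.3] -/
theorem typeRank_sigmaType_add_card_eq_of_stabOrbit_sums_eq_zero {ρ : G} {Φ : ∀ i, Set (E i)}
    (h : ∀ i, IsCMTypeWith ρ (Φ i)) {i₀ i₁ : I} (hI : ∀ j, j = i₀ ∨ j = i₁) (h01 : i₀ ≠ i₁)
    (hbal : ∀ x₀ : E i₀, ∑ x ∈ Finset.univ.filter
      (fun x : E i₀ => ∃ n : G, (∀ y : E i₁, n • y = y) ∧ n • x₀ = x), antiVec (Φ i₀) (1 : G) x = 0) :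
    typeRank G (sigmaType Φ) + Fintype.card I = (∑ i, typeRank G (Φ i)) + 1 := by
  refine typeRank_sigmaType_add_card_eq_of_span_stabOrbitSum_eq_bot h hI h01 ?_
  rw [Submodule.span_eq_bot]
  rintro _ ⟨x₀, rfl⟩
  funext g
  dsimp only
  rw [stabOrbit_sum_antiVec_eq (W := E i₁) (Φ i₀) g x₀, hbal, Pi.zero_apply]

/-- **TYPE-FREE ADDITIVITY: if every `PW₁`-orbit on `E₀` is stable under the conjugation `ρ`, then
`Hg(A₀ × A₁) = Hg(A₀) × Hg(A₁)` for EVERY CM type `Φ₀` (for `ρ`) and every `Φ₁`.**  For `Aut(ℂ)` on complex embeddings: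
the trace `K₀ ∩ L₁` of the Galois closure of `K₁` on `K₀` is totally real (file C2).
[cite: Gordon1999HodgeAVSurvey, §3 Theorem (proof) and 7.5–7.7] [cite: Shimura1998, §8.3] -/
theorem typeRank_sigmaType_add_card_eq_of_stabOrbit_rho_stable {ρ : G} {Φ : ∀ i, Set (E i)}
    (h : ∀ i, IsCMTypeWith ρ (Φ i)) {i₀ i₁ : I} (hI : ∀ j, j = i₀ ∨ j = i₁) (h01 : i₀ ≠ i₁)
    (hρ : ∀ x₀ : E i₀, ∃ n : G, (∀ y : E i₁, n • y = y) ∧ n • x₀ = ρ • x₀) :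
    typeRank G (sigmaType Φ) + Fintype.card I = (∑ i, typeRank G (Φ i)) + 1 :=
  typeRank_sigmaType_add_card_eq_of_stabOrbit_sums_eq_zero h hI h01 fun x₀ =>
    stabOrbit_sum_antiVec_eq_zero_of_rho_mem (h i₀) x₀ (hρ x₀)

/-- The nondegeneracy reading: under `ρ`-stability of the `PW₁`-orbits on `E₀` the pair `Σ` is nondegenerate iff both
members are (`rank Σ = |E₀ ⊔ E₁|/2 + 1 ⟺ rank Φ_κ = |E_κ|/2 + 1`, `κ = 0, 1`).
[cite: Gordon1999HodgeAVSurvey, 7.5 (3) and 7.6.1] -/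
theorem typeRank_sigmaType_eq_iff_forall_of_stabOrbit_rho_stable {ρ : G} {Φ : ∀ i, Set (E i)}
    (h : ∀ i, IsCMTypeWith ρ (Φ i)) {i₀ i₁ : I} (hI : ∀ j, j = i₀ ∨ j = i₁) (h01 : i₀ ≠ i₁)
    (hρ : ∀ x₀ : E i₀, ∃ n : G, (∀ y : E i₁, n • y = y) ∧ n • x₀ = ρ • x₀) :
    typeRank G (sigmaType Φ) = Fintype.card (Σ i, E i) / 2 + 1 ↔
      ∀ i, typeRank G (Φ i) = Fintype.card (E i) / 2 + 1 := by
  haveI : Nonempty I := ⟨i₀⟩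
  exact typeRank_sigmaType_eq_iff_forall_of_forall_map_le h
    ((forall_map_slotExt_le_iff_typeRank_sigmaType_add_card_eq h).2
      (typeRank_sigmaType_add_card_eq_of_stabOrbit_rho_stable h hI h01 hρ))

end Defect

end Summit.HodgeConjecture.CorCM.IrrOdd

end
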